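import Summits.Ventures.HodgeRepro2.T5BergmanKernel
import Summits.Ventures.HodgeRepro2.T5BergmanU11

/-!
# The coherent states on `H_j = U(1,1)`

On `U(1,1) = Z · SU(1,1)` the weight-`k` model `actU` (`T5BergmanU11`) moves the lowest-weight vector to
the kernel functions of `T5BergmanKernel` up to the central character and the automorphy scalar:

  `(π_k(λ g) 1)(w) = λ^k a^{-k} K_{g·0}(w)`   (`g = su11 a b ∈ SU(1,1)`, `λ ∈ U(1)`; `actU_lowest_eq_kernel`),

so the orbit of `1` under `U(1,1)` is the family `{c · K_z : z ∈ 𝔻, c ∈ ℂˣ}` of (scaled) kernel functions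
— the coherent states of the model on `H_j`.  The orbit point is `orbitU (λ g) = g · 0`
(`T5U11CoefficientL2.orbitU_mulHom`), so the kernel is attached to `orbitU`.

Blind lane: Mathlib + the HodgeRepro2 prefix only; no sorry; axioms ⊆ {propext, Classical.choice,
Quot.sound}.
-/

namespace Summit.Ventures.HodgeRepro2.T5BergmanKernelU11

open T5SU11Unimodular T5U11Unimodular T5U11Product T5SU11Fibration T5U11CoefficientL2
open T5BergmanCoefficient T5BergmanU11 T5BergmanKernel

/-- **The coherent states on `U(1,1)`**: `(π_k(λ g) 1)(w) = λ^k a^{-k} K_{g·0}(w)`. -/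
theorem actU_lowest_eq_kernel (k : ℕ) (lam : Circle) (g : SU11) (w : ℂ) :
    actU k (mulHom (lam, g)) lowest w =
      (lam : ℂ) ^ k * ((mat g 0 0)⁻¹ ^ k * kernel k (orbit g) w) := by
  rw [actU_mulHom, act_lowest_eq_kernel]

/-- The same with the orbit point of `U(1,1)`: `orbitU (λ g) = g · 0`. -/
theorem actU_lowest_eq_kernel_orbitU (k : ℕ) (lam : Circle) (g : SU11) (w : ℂ) :
    actU k (mulHom (lam, g)) lowest w =
      (lam : ℂ) ^ k * ((mat g 0 0)⁻¹ ^ k * kernel k (orbitU (mulHom (lam, g))) w) := by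
  rw [actU_lowest_eq_kernel, orbitU_mulHom]

/-- Every `h ∈ U(1,1)` moves `1` to a non-zero multiple of a kernel function at `orbitU h ∈ 𝔻`. -/
theorem exists_actU_lowest_eq_smul_kernel (k : ℕ) (h : U11) :
    ∃ c : ℂ, c ≠ 0 ∧ ∀ w, actU k h lowest w = c * kernel k (orbitU h) w := by
  obtain ⟨⟨lam, g⟩, rfl⟩ := mulHom_surjective h
  refine ⟨(lam : ℂ) ^ k * (mat g 0 0)⁻¹ ^ k, ?_, fun w => ?_⟩
  · have hab := normSq_sub_normSq g
    have ha : mat g 0 0 ≠ 0 := by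
      intro h0
      have : Complex.normSq (mat g 0 0) - Complex.normSq (mat g 0 1) = 1 := hab
      rw [h0, map_zero] at this
      linarith [Complex.normSq_nonneg (mat g 0 1)]
    exact mul_ne_zero (pow_ne_zero _ (Circle.coe_ne_zero lam)) (pow_ne_zero _ (inv_ne_zero ha))
  · rw [actU_lowest_eq_kernel_orbitU]
    ring

end Summit.Ventures.HodgeRepro2.T5BergmanKernelU11
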